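import Summits.CriticalPhenomena.SAWScalingLimit.Theorems.SAWRenewalTightnessTightIdentificationGlue
import Summits.CriticalPhenomena.SAWScalingLimit.Theses.SAWRingGibbsDescent

/-!
# Route `SAWRingGibbsDescent`: the assembly frame

Item `stmt-CriticalPhenomena-11282` (`Assembly : SubseqIdentification → EventualTight →
SAWScalingLimit`, with `EventualTight` = stmt-CriticalPhenomena-1372, set-level tightness of the
pushed critical SAW laws on an initial mesh interval, and `SubseqIdentification` =
stmt-CriticalPhenomena-0783), immediate from `saw_convergesInLawToSLE_of_isTightMeasureSet_image`
of `SAWRenewalTightnessTightIdentificationGlue.lean`.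

## References

* P. Billingsley, *Convergence of Probability Measures*, 2nd ed. (1999), Thm. 5.1 and its
  Corollary [BillingsleyCPM1999].
-/

noncomputable section

namespace Summit.CriticalPhenomena.SAWScalingLimit.Theorems

/-- **Item `stmt-CriticalPhenomena-11282` (`SAWRingGibbsDescent.Assembly`):
`SubseqIdentification → EventualTight → SAWScalingLimit`.** For each `(D, a, b)` with
`IsEndpointApprox`, the `δ₀` of `EventualTight` feeds
`saw_convergesInLawToSLE_of_isTightMeasureSet_image`, and `SubseqIdentification` identifies the
subsequential limit laws. [cite: BillingsleyCPM1999, Thm. 5.1, Corollary] -/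
theorem ringGibbsDescent_assembly_proof : Theses.SAWRingGibbsDescent.Assembly := by
  intro hI hT D a b hab
  obtain ⟨δ₀, hδ₀, htight⟩ := hT D a b hab
  refine saw_convergesInLawToSLE_of_isTightMeasureSet_image hab hδ₀ htight ?_
  rintro μ hμ ⟨s, hs, hlim⟩
  exact hI D a b hab s μ hs hμ hlim

end Summit.CriticalPhenomena.SAWScalingLimit.Theorems
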